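/-
Copyright (c) 2026 the pub-hodgecm-mathlib formalisation cell (harness21).  Prover seat hodgecm-mathlib-K2Liu-p09 (g6): Track B «K2-LIT»,
hLiu418 = stmt-HodgeConjecture-24832; LEAD F0P6-plan RULING M-158d «A7-val road (σ)», file V7a (the intertwining integral of a flat family through a big-cell section).
-/
import Summits.HodgeConjecture.HodgeConjecture.Theorems.K2LiuA7ValueFunctional            -- ★ V1 (heights `absDetDelta_eq_of_mul_eq_mul`, `apply_eq_cpow_mul_apply`)
import Summits.HodgeConjecture.HodgeConjecture.Theorems.K2LiuA7NormalisedRegularitySetup   -- ★ `continuous_of_isSmooth`, `isClosed_unipDeltaLocal`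
import HarnessLib

/-!
# Crux `HLiu418`, road `K2_Liu`, organ A7-val, file V7a: THE INTERTWINING INTEGRAL OF A FLAT FAMILY THROUGH A BIG-CELL SECTION IS A FINITE LAURENT SUM

Cell `hodgecm-mathlib`, crux item hLiu418 = `stmt-HodgeConjecture-24832`; squad K2 ∕ K2Liu; prover K2Liu-p09 (g6), organ lead A7-val.  THEOREMS ONLY; lane
`--supports stmt-HodgeConjecture-24832` (count-neutral helper).  Rank-generic, frame-free, every finite place; the mechanism of the V7 witness of road (σ)
(memo `REPORT-FIRST-A7val-PaperFirst.K2Liu-p09-g6.md` §3 V7): for a `K₀`-flat family `f` of Siegel sections whose member `f s₁` is smooth and BIG-CELL AT `1`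
(`u ↦ f s₁ (w_Δ u)` vanishes off a compact `C ⊆ N_Δ(F_v)`), the Iwasawa height `ν(x) = |det_Δ p(x)|_v` (★ V1 §2) is locally constant, so takes finitely many
values `r ∈ q_v^ℤ` on `w_Δ C`, and `f s (w_Δ u) = ν(w_Δ u)^{s − s₁} f s₁ (w_Δ u)` (★ V1 `apply_eq_cpow_mul_apply`); hence
* `localIntertwining_flat_eq_finset_sum` — **`M_v(s)(f s)(1) = Σ_{r} r^{s − s₁} · c_r` for ALL `s`**, with `c_r = ∫_{ν(w_Δ u) = r} f s₁ (w_Δ u) dνN` and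
  **`Σ_r c_r = Λ(f s₁) := ∫_{N_Δ} f s₁ (w_Δ u) dνN`** — an entire Laurent polynomial in `q_v^{−s}` whose value at `s₁` is `Λ`.  With ★ V1 `value_unique` this computes
  the value functional on big-cell sections: `ℳ(φ)(1) = Λ(φ) · (1∕aNorm)(½)` (file V7b, `n = 2`), non-zero iff `Λ(φ) ≠ 0` at every place where `1∕a_2` does not
  vanish at `½` (all non-split `v`); at split `v` it shows that big-cell sections are KILLED by `ℳ` (the pole of `ζ_{F_v}(2s − 1)`).
HONEST LABEL.  `HC_CM` is proved only modulo the 7 printed citations (2 remaining named inputs: hLiu418 = `stmt-HodgeConjecture-24832`,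
h413 = `stmt-HodgeConjecture-24833`) until rung 0 closes.

## References
* [KudlaSweet1997] S. Kudla, W. J. Sweet, Israel J. Math. 98 (1997), §1 (sections supported in the big cell; `M(s)` on them).
* [Casselman1980] W. Casselman, Compositio Math. 40 (1980), §3 (rationality on flat sections).
* [HarrisKudlaSweet1996] M. Harris, S. Kudla, W. J. Sweet, J. AMS 9 (1996), §1 (1.15), §6 (6.14).
-/

set_option autoImplicit false
set_option linter.dupNamespace false -- the mandated namespace repeats `HodgeConjecture.HodgeConjecture`

noncomputable section

open scoped Classical NNReal ENNReal
open NumberField IsDedekindDomain MeasureTheory Topology Set Filter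
open Literature.NumberTheory.GaloisRepresentations Literature.NumberTheory.GaloisRepresentations.IsNonarchimedeanLocalField
open Literature.NumberTheory.Automorphic Literature.NumberTheory.Automorphic.UnitaryGroup
open Literature.NumberTheory.GelbartRogawski1991.UnitaryDualPair.LocalSplitting
open Literature.NumberTheory.K2Lit.LocalSiegelDoubled
open Summit.HodgeConjecture.HodgeConjecture.Cruxes.HLiu418.K2LiuLocalSiegel
open Summit.HodgeConjecture.HodgeConjecture.Cruxes.HLiu418.K2LiuLocalIntertwiningProperty
open Summit.HodgeConjecture.HodgeConjecture.Cruxes.HLiu418.K2LiuFlatSiegelFamilies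
open Summit.HodgeConjecture.HodgeConjecture.Cruxes.HLiu418.K2LiuA7ValueFunctional
open Summit.HodgeConjecture.HodgeConjecture.Cruxes.HLiu418.K2LiuA7NormalisedRegularitySetup

namespace Summit.HodgeConjecture.HodgeConjecture.Cruxes.HLiu418.K2LiuA7ValueBigCell

variable (F : Type) [Field F] [NumberField F] (E : Type) [Field E] [NumberField E] [Algebra F E]
  [Algebra.IsQuadraticExtension F E] (c : E ≃ₐ[F] E)
  {δ : E} (hcδ : c δ = -δ) (hδ : δ ≠ 0) {d : F} (hd : δ * δ = algebraMap F E d) (v : HeightOneSpectrum (𝓞 F)) (n : ℕ)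
  {T₀ : Matrix (Fin n) (Fin n) F} (hT₀ : T₀.IsSymm) {JD : Matrix (Fin (n + n)) (Fin (n + n)) E} (hJD : JD = (gramD F n T₀).map (algebraMap F E))
  (χv : ∀ w : PlacesOver E v, (w.1.adicCompletion E)ˣ →* ℂˣ)
  (K₀ : Subgroup (UnitaryGroup.localPi E c (n + n) JD v))
  (hK₀ : IsCompact (K₀ : Set (UnitaryGroup.localPi E c (n + n) JD v)) ∧ IsOpen (K₀ : Set (UnitaryGroup.localPi E c (n + n) JD v)))
  (hIw : ∀ x : UnitaryGroup.localPi E c (n + n) JD v, ∃ p, IsSiegelDelta F E c hcδ hδ hd v n hT₀ hJD p ∧ ∃ k ∈ K₀, x = p * k)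

/-! ## §1 The Iwasawa height is locally constant -/

section Height

include hcδ hδ hd hT₀ hJD hK₀ hIw in
/-- **A LOCALLY CONSTANT IWASAWA HEIGHT ON `N_Δ` ALONG THE BIG CELL**: there is `ν : H_v → ℝ` with `ν(p x) = |det_Δ p|_v` whenever `x ∈ K₀`... precisely: `ν x = |det_Δ p|_v`
for EVERY Iwasawa decomposition `x = p k` (★ V1 `absDetDelta_eq_of_mul_eq_mul`), `ν` takes values in `q_v^ℤ`, and `u ↦ ν(w_Δ u)` is locally constant on `N_Δ(F_v)`
(`ν` is right-`K₀`-invariant and `K₀` is open). [cite: KudlaSweet1997, §1] [cite: Casselman1980, §3] -/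
theorem exists_height :
    ∃ ν : UnitaryGroup.localPi E c (n + n) JD v → ℝ,
      (∀ (p k : UnitaryGroup.localPi E c (n + n) JD v), IsSiegelDelta F E c hcδ hδ hd v n hT₀ hJD p → k ∈ K₀ → ν (p * k) = absDetDelta F E c v n p) ∧
      (∀ x, ∃ K : ℤ, ν x = (residueFieldCard (v.adicCompletion F) : ℝ) ^ K) ∧
      (∀ (x k : UnitaryGroup.localPi E c (n + n) JD v), k ∈ K₀ → ν (x * k) = ν x) ∧
      IsLocallyConstant fun u : unipDeltaLocal F E c v n (JD := JD) => ν (weylDelta F E c v n hJD * (u : UnitaryGroup.localPi E c (n + n) JD v)) := by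
  choose pI hpI kI hkI hxI using hIw
  refine ⟨fun x => absDetDelta F E c v n (pI x), fun p k hp hk => ?_, fun x => exists_absDetDelta_eq_zpow F E c hcδ hδ hd v n hT₀ hJD (hpI x), ?_, ?_⟩
  · exact absDetDelta_eq_of_mul_eq_mul F E c hcδ hδ hd v n hT₀ hJD K₀ hK₀.1 (hpI _) hp (hkI _) hk (by rw [← hxI (p * k)])
  · intro x k hk
    exact absDetDelta_eq_of_mul_eq_mul F E c hcδ hδ hd v n hT₀ hJD K₀ hK₀.1 (hpI _) (hpI x) (hkI _) (K₀.mul_mem (hkI x) hk)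
      (by rw [← hxI (x * k), ← mul_assoc, ← hxI x])
  · refine (IsLocallyConstant.iff_eventually_eq _).2 fun u₀ => ?_
    -- `ν(w u) = ν(w u₀)` as soon as `u₀⁻¹ u ∈ K₀`
    have hcont : Continuous fun u : unipDeltaLocal F E c v n (JD := JD) =>
        ((u₀ : UnitaryGroup.localPi E c (n + n) JD v))⁻¹ * (u : UnitaryGroup.localPi E c (n + n) JD v) :=
      continuous_const.mul continuous_subtype_val
    have hmem : (fun u : unipDeltaLocal F E c v n (JD := JD) => ((u₀ : UnitaryGroup.localPi E c (n + n) JD v))⁻¹ * (u : UnitaryGroup.localPi E c (n + n) JD v)) ⁻¹'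
        (K₀ : Set (UnitaryGroup.localPi E c (n + n) JD v)) ∈ 𝓝 u₀ :=
      (hK₀.2.preimage hcont).mem_nhds (by simp [K₀.one_mem])
    filter_upwards [hmem] with u hu
    have h1 : weylDelta F E c v n hJD * (u : UnitaryGroup.localPi E c (n + n) JD v) =
        weylDelta F E c v n hJD * (u₀ : UnitaryGroup.localPi E c (n + n) JD v) * (((u₀ : UnitaryGroup.localPi E c (n + n) JD v))⁻¹ * u) := by group
    rw [h1]
    exact absDetDelta_eq_of_mul_eq_mul F E c hcδ hδ hd v n hT₀ hJD K₀ hK₀.1 (hpI _) (hpI _) (hkI _) (K₀.mul_mem (hkI _) hu)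
      (by rw [← hxI, ← mul_assoc (pI _) (kI _), ← hxI])

end Height

/-! ## §2 The intertwining integral of a flat family through a big-cell section -/

section BigCell

variable [MeasurableSpace (unipDeltaLocal F E c v n (JD := JD))] [BorelSpace (unipDeltaLocal F E c v n (JD := JD))]
  (νN : Measure (unipDeltaLocal F E c v n (JD := JD))) [IsFiniteMeasureOnCompacts νN]
  {f : ℂ → UnitaryGroup.localPi E c (n + n) JD v → ℂ} (hSieg : ∀ s, IsLocalSiegelSection F E c hcδ hδ hd v n hT₀ hJD χv s (f s))
  (hflat : ∀ s s' : ℂ, ∀ k ∈ K₀, f s k = f s' k) (s₁ : ℂ) (hsm : IsSmooth F E c v n (f s₁))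
  (C : Set (unipDeltaLocal F E c v n (JD := JD))) (hC : IsCompact C)
  (hsupp : ∀ u : unipDeltaLocal F E c v n (JD := JD), u ∉ C → f s₁ (weylDelta F E c v n hJD * (u : UnitaryGroup.localPi E c (n + n) JD v)) = 0)

include hcδ hδ hd hT₀ hJD hK₀ hIw hSieg hflat hsm hC hsupp in
/-- **`M_v(s)(f s)(1)` IS A FINITE LAURENT SUM** for a `K₀`-flat family of Siegel sections whose member `f s₁` is smooth and big-cell at `1`:
`M_v(s)(f s)(1) = Σ_{r ∈ R} r^{s − s₁} · c_r` for every `s : ℂ`, with `R ⊆ q_v^ℤ` finite (the heights met on the compact support) and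
`Σ_{r ∈ R} c_r = ∫_{N_Δ} f s₁ (w_Δ u) dνN = Λ(f s₁)`. [cite: KudlaSweet1997, §1] [cite: Casselman1980, §3] -/
theorem localIntertwining_flat_eq_finset_sum :
    ∃ (R : Finset ℝ) (cR : ℝ → ℂ), (∀ r ∈ R, ∃ K : ℤ, r = (residueFieldCard (v.adicCompletion F) : ℝ) ^ K) ∧
      (∀ s : ℂ, localIntertwining F E c v n hJD νN (f s) 1 = ∑ r ∈ R, ((r : ℝ) : ℂ) ^ (s - s₁) * cR r) ∧
      ∑ r ∈ R, cR r = ∫ u, f s₁ (weylDelta F E c v n hJD * (u : UnitaryGroup.localPi E c (n + n) JD v)) ∂νN := by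
  obtain ⟨ν, hνIw, hνpow, hνK, hνlc⟩ := exists_height F E c hcδ hδ hd v n hT₀ hJD K₀ hK₀ hIw
  -- abbreviations: the height along the big cell and the member at `s₁` along the big cell
  set η : unipDeltaLocal F E c v n (JD := JD) → ℝ := fun u => ν (weylDelta F E c v n hJD * (u : UnitaryGroup.localPi E c (n + n) JD v)) with hη
  set g : unipDeltaLocal F E c v n (JD := JD) → ℂ := fun u => f s₁ (weylDelta F E c v n hJD * (u : UnitaryGroup.localPi E c (n + n) JD v)) with hg
  -- the flat family along the big cell: `f s (w u) = η(u)^{s − s₁} g(u)`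
  have hfs : ∀ (s : ℂ) (u : unipDeltaLocal F E c v n (JD := JD)),
      f s (weylDelta F E c v n hJD * (u : UnitaryGroup.localPi E c (n + n) JD v)) = ((η u : ℝ) : ℂ) ^ (s - s₁) * g u := by
    intro s u
    obtain ⟨p, hp, k, hk, hx⟩ := hIw (weylDelta F E c v n hJD * (u : UnitaryGroup.localPi E c (n + n) JD v))
    rw [hη, hg]
    simp only []
    rw [hx, hνIw p k hp hk]
    exact apply_eq_cpow_mul_apply F E c hcδ hδ hd v n hT₀ hJD χv hSieg hflat hp hk s s₁
  -- `g` is continuous with support in the compact `C`, hence integrable; the fibres of `η` are clopen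
  have hgc : Continuous g := (continuous_of_isSmooth F E c v n hsm).comp (continuous_const.mul continuous_subtype_val)
  have hgsupp : HasCompactSupport g := HasCompactSupport.intro hC fun u hu => hsupp u hu
  have hgi : Integrable g νN := hgc.integrable_of_hasCompactSupport hgsupp
  have hfib : ∀ r : ℝ, MeasurableSet {u : unipDeltaLocal F E c v n (JD := JD) | η u = r} := fun r => (hνlc.isClopen_fiber r).2.measurableSet
  -- the finite set of heights met on `C`
  haveI : CompactSpace C := isCompact_iff_compactSpace.1 hC
  have hfin : (Set.range (η ∘ ((↑) : C → unipDeltaLocal F E c v n (JD := JD)))).Finite := (hνlc.comp_continuous continuous_subtype_val).range_finite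
  refine ⟨hfin.toFinset, fun r => ∫ u, {u | η u = r}.indicator g u ∂νN, fun r hr => ?_, fun s => ?_, ?_⟩
  · obtain ⟨u, rfl⟩ := hfin.mem_toFinset.1 hr
    exact hνpow _
  · -- pointwise: `f s (w u) = Σ_{r ∈ R} r^{s−s₁} 𝟙[η u = r] g u`
    have hpt : ∀ u : unipDeltaLocal F E c v n (JD := JD),
        f s (weylDelta F E c v n hJD * (u : UnitaryGroup.localPi E c (n + n) JD v) * 1) =
          ∑ r ∈ hfin.toFinset, ((r : ℝ) : ℂ) ^ (s - s₁) * {u | η u = r}.indicator g u := by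
      intro u
      rw [mul_one, hfs]
      simp only [Set.indicator_apply, Set.mem_setOf_eq, mul_ite, mul_zero]
      by_cases hu : u ∈ C
      · have hmem : η u ∈ hfin.toFinset := hfin.mem_toFinset.2 ⟨⟨u, hu⟩, rfl⟩
        rw [Finset.sum_eq_single (η u) (fun r _ hr => if_neg fun h => hr h.symm) (fun h => absurd hmem h), if_pos rfl]
      · have h0 : g u = 0 := hsupp u hu
        rw [h0, mul_zero]
        exact (Finset.sum_eq_zero fun r _ => by rw [mul_zero, ite_self]).symm
    unfold localIntertwining
    rw [integral_congr_ae (Eventually.of_forall hpt), integral_finsetSum _ fun r _ => ((hgi.indicator (hfib r)).const_mul _)]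
    exact Finset.sum_congr rfl fun r _ => integral_const_mul _ _
  · -- `Σ_r c_r = ∫ g`
    rw [← integral_finsetSum _ fun r _ => hgi.indicator (hfib r)]
    refine integral_congr_ae (Eventually.of_forall fun u => ?_)
    change ∑ r ∈ hfin.toFinset, {u' | η u' = r}.indicator g u = g u
    simp only [Set.indicator_apply, Set.mem_setOf_eq]
    by_cases hu : u ∈ C
    · have hmem : η u ∈ hfin.toFinset := hfin.mem_toFinset.2 ⟨⟨u, hu⟩, rfl⟩
      rw [Finset.sum_eq_single (η u) (fun r _ hr => if_neg fun h => hr h.symm) (fun h => absurd hmem h), if_pos rfl]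
    · have h0 : g u = 0 := hsupp u hu
      rw [h0]
      exact Finset.sum_eq_zero fun r _ => ite_self _

end BigCell

end Summit.HodgeConjecture.HodgeConjecture.Cruxes.HLiu418.K2LiuA7ValueBigCell

end
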